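import Summits.HodgeConjecture.CorCM.Census.QuarticTwistGenerate

/-!
# The quartic twist `(ℤ/4 × B, (2,0))`, VIII: THE COUNT — a generating family of `β − 1` faces (`|B|` odd `≥ 3`)

COR-CM (cell `pub-hodgecm2`), count-neutral kernel combinatorics by the binder seat b09 (gen 32; lane QUARTIC-TWIST), part VIII, sequel of
`Census/QuarticTwistGenerate.lean`.  Theorems + two bookkeeping definitions (`orbitRel`, `Orb`: the blocks = `G`-orbits of clock types);
no `decide` table, no certificate, no named fact, no geometry, no `sorry`.  HONEST FRAMING: `HC_CM` is NOT proved, here or anywhere in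
the tree; nothing here is a headline and nothing here produces a period.

**THEOREM (`exists_faces_generate`).**  For every finite group `B` of odd order `≥ 3` there is a finite family `S` of rank-four faces of
the quartic twist `(ℤ/4 × B, (2,0))` with
  `hodge B ≤ pairs B ⊔ spanFaces B S`  and  `S.card + 1 = β := Fintype.card (Orb B)`,
`β` the number of blocks (`G`-orbits of clock types; the simple CM isogeny classes split by the field).  Construction: the four RESIDUAL
blocks are those of `u`, `u + δ_b`, `u − δ_b`, `u + 2δ_b` (§1); through a representative of every other block choose ONE cross square with
`Φ`-smaller corners (§2, it exists: two columns off the regime, each moved toward it), and add the three closing faces of part VII.  With the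
coinvariant floor of `Census/CoinvariantFloor.lean` / `Census/BlockParityRelations.lean` (`δ = 0` since `(1,0)` has order `4 ∤ 2|B|`) this
is the exact face count `μ(ℤ/4 × B) = β − 1 = φ₂` — the first generation theorem for TWISTED non-cyclic Galois CM types (`ℤ/4 × (ℤ/3)²`,
`ℤ/4 × (ℤ/7 ⋊ ℤ/3)`, …); the transport to the intrinsic currency `CMF G c` / `hgen` is left to a sequel.  All [folklore].

## References
* [Pohlmann1968] H. Pohlmann, Algebraic cycles on abelian varieties of complex multiplication type, Ann. of Math. 88 (1968), Thm 1.
* [Milne1999] J. S. Milne, Lefschetz motives and the Tate conjecture, Compositio Math. 117 (1999), Prop. 2.1, p. 54.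
-/

namespace Summit.HodgeConjecture.CorCM.Census.QuarticTwist

open Finset

variable (B : Type) [AddGroup B] [Fintype B] [DecidableEq B]

/-! ## §1 Blocks; the four residual blocks -/

/-- **The orbit relation** of `G = ℤ/4 × B` on clock types. [folklore] -/
def orbitRel : Setoid (Ty B) where
  r s s' := ∃ g : ZMod 4 × B, tw B g s = s'
  iseqv := by
    refine ⟨fun s => ⟨0, tw_zero B s⟩, ?_, ?_⟩
    · rintro s s' ⟨g, rfl⟩
      exact ⟨-g, tw_neg_tw B g s⟩
    · rintro s s' s'' ⟨g, rfl⟩ ⟨h, rfl⟩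
      exact ⟨h + g, (tw_tw B h g s).symm⟩

/-- **The blocks**: `G`-orbits of clock types (the simple CM isogeny classes split by the field, in the dictionary). [folklore] -/
abbrev Orb : Type := Quotient (orbitRel B)

/-- The blocks form a finite type. [folklore] -/
noncomputable instance : Fintype (Orb B) := Fintype.ofFinite _

omit [Fintype B] in
/-- Residual types stay residual under the action. [folklore] -/
theorem isRes_tw {s : Ty B} (hs : IsRes B s) (g : ZMod 4 × B) : IsRes B (tw B g s) := by
  obtain ⟨u, b, k, rfl⟩ := hs
  exact ⟨u + g.1, b - g.2, k, tw_atom B g u b k⟩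

omit [Fintype B] in
/-- Residual-ness is a property of the block. [folklore] -/
theorem isRes_iff_of_rel {s s' : Ty B} (h : (orbitRel B).r s s') : IsRes B s ↔ IsRes B s' := by
  obtain ⟨g, rfl⟩ := h
  refine ⟨fun hs => isRes_tw B hs g, fun hs => ?_⟩
  have := isRes_tw B hs (-g)
  rwa [tw_neg_tw] at this

omit [Fintype B] in
/-- Every atom lies in the block of the atom `0 + k·δ_{b₀}` of the same kind `k`. [folklore] -/
theorem mk_atom_eq (b₀ : B) (u : ZMod 4) (b : B) (k : ZMod 4) :
    (Quotient.mk (orbitRel B) (atom B u b k) : Orb B) = Quotient.mk (orbitRel B) (atom B 0 b₀ k) := by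
  refine Quotient.sound ⟨(-u, -b₀ + b), ?_⟩
  rw [tw_atom, add_neg_cancel, sub_neg_add_self]

/-- **The four residual blocks are distinct**: atoms of different kinds `k ≠ k'` (`k, k'` not both `0`… precisely `k ≠ 0`) lie in
different blocks (`|B| ≥ 3`). [folklore] -/
theorem mk_atom_ne (h3 : 3 ≤ Fintype.card B) (b₀ : B) {k k' : ZMod 4} (hk : k ≠ 0) (hkk : k ≠ k') :
    (Quotient.mk (orbitRel B) (atom B 0 b₀ k) : Orb B) ≠ Quotient.mk (orbitRel B) (atom B 0 b₀ k') := by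
  intro h
  obtain ⟨g, hg⟩ := Quotient.exact h
  rw [tw_atom] at hg
  exact hkk ((atom_eq_atom_iff B h3 hk).mp hg).2.2

/-! ## §2 A `Φ`-decreasing cross square through every non-residual type; the equatorial data -/

/-- From a value off the regime there is a `±1` step lowering the Lee weight. [folklore] -/
theorem exists_step_toward {x u : ZMod 4} (h : x ≠ u) : ∃ e : ZMod 4, (e = 1 ∨ e = -1) ∧ lee (x + e - u) + 1 = lee (x - u) := by
  have key : ∀ x u : ZMod 4, x ≠ u → (lee (x + 1 - u) + 1 = lee (x - u)) ∨ (lee (x + -1 - u) + 1 = lee (x - u)) := by decide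
  rcases key x u h with h1 | h1
  · exact ⟨1, Or.inl rfl, h1⟩
  · exact ⟨-1, Or.inr rfl, h1⟩

/-- Every `±1` step at a value is the step of one of the two places of the column. [folklore] -/
theorem exists_place (x e : ZMod 4) (he : e = 1 ∨ e = -1) : ∃ j : ZMod 2, step j x = e := by
  rcases he with rfl | rfl
  · exact ⟨par x, if_pos rfl⟩
  · refine ⟨par x + 1, ?_⟩
    rw [step_succ]; exact congrArg Neg.neg (if_pos rfl)

omit [AddGroup B] in
/-- A non-residual type has two columns off its regime. [folklore] -/
theorem exists_two_off (h3 : 3 ≤ Fintype.card B) {s : Ty B} (hs : ¬ IsRes B s) :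
    ∃ b₁ b₂ : B, b₁ ≠ b₂ ∧ s b₁ ≠ reg B s ∧ s b₂ ≠ reg B s := by
  classical
  obtain ⟨b₀⟩ : Nonempty B := Fintype.card_pos_iff.mp (by omega)
  by_cases hall : ∀ b, s b = reg B s
  · exact (hs ⟨reg B s, b₀, 0, funext fun x => by rw [atom_apply, add_zero, hall x]; split_ifs <;> rfl⟩).elim
  · obtain ⟨b₁, hb₁⟩ := not_forall.mp hall
    by_cases hall2 : ∀ b, b ≠ b₁ → s b = reg B s
    · refine (hs ⟨reg B s, b₁, s b₁ - reg B s, funext fun x => ?_⟩).elim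
      rw [atom_apply]
      by_cases hx : x = b₁
      · rw [if_pos hx, hx]; ring
      · rw [if_neg hx, hall2 x hx]
    · obtain ⟨b₂, hb₂⟩ := not_forall.mp hall2
      obtain ⟨hne, hb₂'⟩ := Classical.not_imp.mp hb₂
      exact ⟨b₂, b₁, hne, hb₂', hb₁⟩

omit [AddGroup B] in
/-- **Through every non-residual type there is a cross square with `Φ`-smaller corners** (`|B| ≥ 3`; the regime is the first
minimising one). [folklore] -/
theorem exists_goodSquare (h3 : 3 ≤ Fintype.card B) {s : Ty B} (hs : ¬ IsRes B s) :
    ∃ p q : ZMod 2 × B, p.2 ≠ q.2 ∧ Phi B (flip B p s) < Phi B s ∧ Phi B (flip B q s) < Phi B s ∧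
      Phi B (flip B q (flip B p s)) < Phi B s := by
  obtain ⟨b₁, b₂, hb, h₁, h₂⟩ := exists_two_off B h3 hs
  obtain ⟨e₁, he₁, hl₁⟩ := exists_step_toward h₁
  obtain ⟨e₂, he₂, hl₂⟩ := exists_step_toward h₂
  obtain ⟨j₁, hj₁⟩ := exists_place (s b₁) e₁ he₁
  obtain ⟨j₂, hj₂⟩ := exists_place (s b₂) e₂ he₂
  refine ⟨(j₁, b₁), (j₂, b₂), hb, ?_, ?_, ?_⟩
  · have hf : flip B (j₁, b₁) s = s + Pi.single b₁ e₁ := by rw [flip_eq_add_single, hj₁]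
    have hd := L_move_toward B (reg B s) s b₁ e₁ hl₁
    have := Phi_le B (reg B s) (s + Pi.single b₁ e₁)
    have hP := L_reg B s
    rw [hf]; omega
  · have hf : flip B (j₂, b₂) s = s + Pi.single b₂ e₂ := by rw [flip_eq_add_single, hj₂]
    have hd := L_move_toward B (reg B s) s b₂ e₂ hl₂
    have := Phi_le B (reg B s) (s + Pi.single b₂ e₂)
    have hP := L_reg B s
    rw [hf]; omega
  · have hf : flip B (j₂, b₂) (flip B (j₁, b₁) s) = flip B (j₁, b₁) s + Pi.single b₂ e₂ := by
      rw [flip_eq_add_single B (j₂, b₂), flip_apply_of_ne B (j₁, b₁) s (Ne.symm hb), hj₂]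
    have hf₁ : flip B (j₁, b₁) s = s + Pi.single b₁ e₁ := by rw [flip_eq_add_single, hj₁]
    have hd₁ := L_move_toward B (reg B s) s b₁ e₁ hl₁
    have hl₂' : lee (flip B (j₁, b₁) s b₂ + e₂ - reg B s) + 1 = lee (flip B (j₁, b₁) s b₂ - reg B s) := by
      rw [flip_apply_of_ne B (j₁, b₁) s (Ne.symm hb)]; exact hl₂
    have hd₂ := L_move_toward B (reg B s) (flip B (j₁, b₁) s) b₂ e₂ hl₂'
    have := Phi_le B (reg B s) (flip B (j₁, b₁) s + Pi.single b₂ e₂)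
    have hP := L_reg B s
    rw [hf₁] at hd₂ this
    rw [hf, hf₁]; omega

omit [AddGroup B] in
/-- **Equatorial data**: for `|B| = 2m + 1 ≥ 3` there are `Q` with `|Q| = m` and `i ≠ j` outside `Q`. [folklore] -/
theorem exists_equator {m : ℕ} (hm : Fintype.card B = 2 * m + 1) (h1 : 1 ≤ m) :
    ∃ (Q : Finset B) (i j : B), Q.card = m ∧ i ∉ Q ∧ j ∉ Q ∧ j ≠ i := by
  obtain ⟨Q, -, hQ⟩ := Finset.exists_subset_card_eq (s := (univ : Finset B)) (n := m) (by rw [card_univ]; omega)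
  have hc : 1 < (univ \ Q).card := by rw [card_sdiff_of_subset (subset_univ Q), card_univ, hQ]; omega
  obtain ⟨i, hi, j, hj, hij⟩ := Finset.one_lt_card.mp hc
  rw [mem_sdiff] at hi hj
  exact ⟨Q, i, j, hQ, hi.2, hj.2, hij.symm⟩

omit [Fintype B] in
/-- Twists transport flips (place-map form). [folklore] -/
theorem tw_flip' (g : ZMod 4 × B) (p : ZMod 2 × B) (s : Ty B) : tw B g (flip B p s) = flip B (plc B g p) (tw B g s) :=
  tw_flip B g p s

/-! ## §3 The family and the count -/

/-- **EXISTENCE OF A GENERATING FAMILY OF `β − 1` FACES** (`|B|` odd, `≥ 3`): there is a finite family `S` of rank-four faces of the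
quartic twist with `hodge B ≤ pairs B ⊔ spanFaces B S` and `S.card + 1 = Fintype.card (Orb B)` (one `Φ`-decreasing cross square
through a representative of each non-residual block, the column face at `0` in a column `b₀`, the column face at a Boolean half-type
`𝟙_Q` in a column `i ∉ Q`, and the equatorial square `(𝟙_Q; (0,i), (0,j))`). [folklore] -/
theorem exists_faces_generate (hB : Odd (Fintype.card B)) (h3 : 3 ≤ Fintype.card B) :
    ∃ S : Finset (Ty B × (ZMod 2 × B) × (ZMod 2 × B)), (∀ f ∈ S, f.2.1 ≠ f.2.2) ∧ hodge B ≤ pairs B ⊔ spanFaces B S ∧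
      S.card + 1 = Fintype.card (Orb B) := by
  classical
  obtain ⟨m, hm⟩ := hB
  have h1 : 1 ≤ m := by omega
  obtain ⟨Q, i, j, hQ, hi, hj, hji⟩ := exists_equator B hm h1
  obtain ⟨b₀⟩ : Nonempty B := ⟨i⟩
  have hBodd : Odd (Fintype.card B) := ⟨m, hm⟩
  -- the chosen square of a block (dummy on residual blocks)
  have hsq : ∀ ω : Orb B, ∃ pq : (ZMod 2 × B) × (ZMod 2 × B), ¬ IsRes B ω.out →
      (pq.1.2 ≠ pq.2.2 ∧ Phi B (flip B pq.1 ω.out) < Phi B ω.out ∧ Phi B (flip B pq.2 ω.out) < Phi B ω.out ∧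
        Phi B (flip B pq.2 (flip B pq.1 ω.out)) < Phi B ω.out) := by
    intro ω
    by_cases h : IsRes B ω.out
    · exact ⟨((0, b₀), (0, b₀)), fun h' => (h' h).elim⟩
    · obtain ⟨p, q, hpq⟩ := exists_goodSquare B h3 h
      exact ⟨(p, q), fun _ => hpq⟩
  choose pq hpq using hsq
  set sqOf : Orb B → Ty B × (ZMod 2 × B) × (ZMod 2 × B) := fun ω => (ω.out, (pq ω).1, (pq ω).2) with hsqOf
  set NR : Finset (Orb B) := univ.filter fun ω => ¬ IsRes B ω.out with hNR
  set F1 : Ty B × (ZMod 2 × B) × (ZMod 2 × B) := (cst B 0, ((0 : ZMod 2), b₀), ((1 : ZMod 2), b₀)) with hF1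
  set F2 : Ty B × (ZMod 2 × B) × (ZMod 2 × B) := (prof B Q i 0, ((0 : ZMod 2), i), ((1 : ZMod 2), i)) with hF2
  set F3 : Ty B × (ZMod 2 × B) × (ZMod 2 × B) := (prof B Q i 0, ((0 : ZMod 2), i), ((0 : ZMod 2), j)) with hF3
  set S : Finset (Ty B × (ZMod 2 × B) × (ZMod 2 × B)) := NR.image sqOf ∪ {F1, F2, F3} with hSdef
  have h01 : (0 : ZMod 2) ≠ 1 := by decide
  -- membership facts
  have hF1S : F1 ∈ S := mem_union_right _ (by simp)
  have hF2S : F2 ∈ S := mem_union_right _ (by simp)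
  have hF3S : F3 ∈ S := mem_union_right _ (by simp)
  -- (a) places are distinct
  have hS : ∀ f ∈ S, f.2.1 ≠ f.2.2 := by
    intro f hf
    rcases mem_union.mp hf with hf | hf
    · obtain ⟨ω, hω, rfl⟩ := mem_image.mp hf
      have hω' : ¬ IsRes B ω.out := (mem_filter.mp hω).2
      intro h
      exact (hpq ω hω').1 (congrArg Prod.snd h)
    · simp only [mem_insert, mem_singleton] at hf
      rcases hf with rfl | rfl | rfl
      · exact fun h => h01 (congrArg Prod.fst h)
      · exact fun h => h01 (congrArg Prod.fst h)
      · exact fun h => hji (congrArg Prod.snd h).symm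
  -- (b) the family covers
  have hcov : Covers B (pairs B ⊔ spanFaces B S) := by
    intro s hs
    set ω : Orb B := Quotient.mk (orbitRel B) s with hω
    have hrel : (orbitRel B).r ω.out s := Quotient.exact (Quotient.out_eq ω)
    obtain ⟨g, hg⟩ := hrel
    have hω' : ¬ IsRes B ω.out := fun h => hs ((isRes_iff_of_rel B ⟨g, hg⟩).mp h)
    have hωNR : ω ∈ NR := mem_filter.mpr ⟨mem_univ _, hω'⟩
    have hmem : sqOf ω ∈ S := mem_union_left _ (mem_image_of_mem _ hωNR)
    obtain ⟨hne, hp1, hp2, hp12⟩ := hpq ω hω'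
    refine ⟨plc B g (pq ω).1, plc B g (pq ω).2, ?_, ?_, ?_, ?_, ?_⟩
    · simp only [plc]; exact fun h => hne (sub_left_injective h)
    · have h := transl_faceVec_mem_spanFaces B hmem g
      rw [hsqOf] at h
      simp only at h
      rw [transl_faceVec, hg] at h
      exact Submodule.mem_sup_right h
    · rw [← hg, ← tw_flip', Phi_tw, Phi_tw]; exact hp1
    · rw [← hg, ← tw_flip', Phi_tw, Phi_tw]; exact hp2
    · rw [← hg, ← tw_flip', ← tw_flip', Phi_tw, Phi_tw]; exact hp12
  -- (c) generation
  have hgen : hodge B ≤ pairs B ⊔ spanFaces B S :=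
    hodge_le_of_family B hBodd hm h1 hS hcov hF1S hQ hi hj hji hF2S hF3S
  refine ⟨S, hS, hgen, ?_⟩
  -- (d) the count: `|S| = |NR| + 3` and `|Orb| = |NR| + 4`
  have hinj : Set.InjOn sqOf ↑NR := by
    intro ω _ ω' _ h
    have h1' : ω.out = ω'.out := congrArg Prod.fst h
    rw [← Quotient.out_eq ω, ← Quotient.out_eq ω', h1']
  have hnot : ∀ ω ∈ NR, sqOf ω ≠ F1 ∧ sqOf ω ≠ F2 ∧ sqOf ω ≠ F3 := by
    intro ω hω
    have hω' : ¬ IsRes B ω.out := (mem_filter.mp hω).2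
    obtain ⟨hne, hp1, -, -⟩ := hpq ω hω'
    refine ⟨fun h => hne ?_, fun h => hne ?_, fun h => ?_⟩
    · simp only [hsqOf, hF1, Prod.mk.injEq] at h
      rw [h.2.1, h.2.2]
    · simp only [hsqOf, hF2, Prod.mk.injEq] at h
      rw [h.2.1, h.2.2]
    · -- the equatorial square is not `Φ`-decreasing: `Φ(𝟙_{Q+i}) = Φ(𝟙_Q) = m`
      simp only [hsqOf, hF3, Prod.mk.injEq] at h
      have hs : ω.out = prof B Q i 0 := h.1
      have hp : (pq ω).1 = ((0 : ZMod 2), i) := h.2.1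
      rw [hs, hp, (corners B Q hi hj hji).1] at hp1
      obtain ⟨r0, r1, -⟩ := reg_corners B hBodd hm h1 Q hQ hi hj hji
      have e0 := L_reg B (prof B Q i 0)
      have e1 := L_reg B (prof B Q i 1)
      rw [r0, L_prof B Q hi] at e0
      rw [r1, L_prof B Q hi] at e1
      have l0 : lee (0 : ZMod 4) = 0 := by decide
      have l1 : lee ((1 : ZMod 4) - 0) = 1 ∧ lee ((0 : ZMod 4) - 0) = 0 ∧ lee ((1 : ZMod 4) - 1) = 0 ∧ lee ((0 : ZMod 4) - 1) = 1 := by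
        refine ⟨?_, ?_, ?_, ?_⟩ <;> decide
      rw [l1.1, l1.2.1] at e0
      rw [l1.2.2.1, l1.2.2.2] at e1
      omega
  have hdisj : Disjoint (NR.image sqOf) {F1, F2, F3} := by
    rw [Finset.disjoint_left]
    intro f hf hf'
    obtain ⟨ω, hω, rfl⟩ := mem_image.mp hf
    simp only [mem_insert, mem_singleton] at hf'
    obtain ⟨n1, n2, n3⟩ := hnot ω hω
    rcases hf' with h | h | h
    · exact n1 h
    · exact n2 h
    · exact n3 h
  have hQne : Q.Nonempty := by rw [← Finset.card_pos, hQ]; exact h1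
  obtain ⟨q, hq⟩ := hQne
  have hcp : cst B 0 ≠ prof B Q i 0 := by
    intro h
    have h' := congrFun h q
    rw [prof_apply_of_mem B Q i 0 hq] at h'
    exact absurd h' (by change (0 : ZMod 4) ≠ 1; decide)
  have hF12 : F1 ≠ F2 := by
    intro h
    simp only [hF1, hF2, Prod.mk.injEq] at h
    exact hcp h.1
  have hF13 : F1 ≠ F3 := by
    intro h
    simp only [hF1, hF3, Prod.mk.injEq] at h
    exact hcp h.1
  have hF23 : F2 ≠ F3 := by
    intro h
    simp only [hF2, hF3, Prod.mk.injEq] at h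
    exact h01.symm h.2.2.1
  have hcard3 : ({F1, F2, F3} : Finset _).card = 3 := by
    rw [card_insert_of_notMem (by simp [hF12, hF13]), card_insert_of_notMem (by simp [hF23]), card_singleton]
  have hScard : S.card = NR.card + 3 := by
    rw [hSdef, card_union_of_disjoint hdisj, card_image_of_injOn hinj, hcard3]
  -- the residual blocks are exactly four
  set R4 : Finset (Orb B) := {Quotient.mk (orbitRel B) (atom B 0 b₀ 0), Quotient.mk (orbitRel B) (atom B 0 b₀ 1),
    Quotient.mk (orbitRel B) (atom B 0 b₀ (-1)), Quotient.mk (orbitRel B) (atom B 0 b₀ 2)} with hR4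
  have hR4card : R4.card = 4 := by
    have n1 := mk_atom_ne B h3 b₀ (k := 1) (k' := 0) (by decide) (by decide)
    have n2 := mk_atom_ne B h3 b₀ (k := -1) (k' := 0) (by decide) (by decide)
    have n3 := mk_atom_ne B h3 b₀ (k := 2) (k' := 0) (by decide) (by decide)
    have n4 := mk_atom_ne B h3 b₀ (k := 1) (k' := -1) (by decide) (by decide)
    have n5 := mk_atom_ne B h3 b₀ (k := 1) (k' := 2) (by decide) (by decide)
    have n6 := mk_atom_ne B h3 b₀ (k := -1) (k' := 2) (by decide) (by decide)
    rw [hR4, card_insert_of_notMem, card_insert_of_notMem, card_insert_of_notMem, card_singleton]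
    · simp only [mem_singleton]; exact n6
    · simp only [mem_insert, mem_singleton, not_or]; exact ⟨n4, n5⟩
    · simp only [mem_insert, mem_singleton, not_or]; exact ⟨n1.symm, n2.symm, n3.symm⟩
  have hres : (univ.filter fun ω : Orb B => IsRes B ω.out) = R4 := by
    ext ω
    simp only [mem_filter, mem_univ, true_and, hR4, mem_insert, mem_singleton]
    constructor
    · rintro ⟨u, b, k, hk⟩
      have hω : ω = Quotient.mk (orbitRel B) (atom B 0 b₀ k) := by
        rw [← Quotient.out_eq ω, hk, mk_atom_eq B b₀]
      have key : ∀ k : ZMod 4, k = 0 ∨ k = 1 ∨ k = -1 ∨ k = 2 := by decide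
      rcases key k with rfl | rfl | rfl | rfl
      · exact Or.inl hω
      · exact Or.inr (Or.inl hω)
      · exact Or.inr (Or.inr (Or.inl hω))
      · exact Or.inr (Or.inr (Or.inr hω))
    · intro h
      have aux : ∀ k : ZMod 4, ω = Quotient.mk (orbitRel B) (atom B 0 b₀ k) → IsRes B ω.out := by
        intro k hk
        have hrel : (orbitRel B).r ω.out (atom B 0 b₀ k) := Quotient.exact (by rw [Quotient.out_eq]; exact hk)
        exact (isRes_iff_of_rel B hrel).mpr ⟨0, b₀, k, rfl⟩
      rcases h with h | h | h | h
      · exact aux 0 h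
      · exact aux 1 h
      · exact aux (-1) h
      · exact aux 2 h
  have hOrb : Fintype.card (Orb B) = NR.card + 4 := by
    rw [← Finset.card_univ, ← Finset.card_filter_add_card_filter_not (fun ω : Orb B => IsRes B ω.out), hres, hR4card, hNR]
    ring
  rw [hScard, hOrb]

end Summit.HodgeConjecture.CorCM.Census.QuarticTwist
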